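import Summits.HodgeConjecture.HodgeConjecture.Theorems.VHCAbelianSchemesRoadServedFibre
import Summits.HodgeConjecture.HodgeConjecture.Theorems.Ring2SemiregularRepresentativesLef
import Summits.HodgeConjecture.HodgeConjecture.Theorems.VHCAbelianSchemesRoadTwistedDoor
import Literature.AlgebraicGeometry.HodgeTheory.AbelianVarietyPullbackAlgebraicClasses
import HarnessLib

/-!
# Road b02 (`VHCAbelianSchemesRoad`) — ALGEBRAICITY ALONG EVERY PENCIL THROUGH A SERVED ANCHOR: door ∧ anchored carrier ⟹ `W` algebraic
# on EVERY fibre (Markman's Thm. 1.5.1 mechanism, anchor-generic, fact-free; no residual, no cell, no `HC_CM`)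

research route conditional on HC_CM; not a corollary; Q11.4-sentence-2 already refuted in dim ≥ 3.

The road closes `HC_AV` through CELLS (a datum at SOME fibre of EVERY pencil). For the algebraicity of ONE class on ONE variety much
less is used: ONE pencil through the variety that passes through a SERVED ANCHOR. This file proves, for every door `𝒪 : ObjClass`
satisfying its local variational Hodge statement (`LocalVariationalHodgeFor 𝒪` — the venture's binder shape; for the road's twisted door
this IS the route binder `TwistedPerfectDoorVHC C AdmTw`, `Iff.rfl`), every cell index `(n, p)` and every anchor data `(𝔄, 𝔖)`
with `AnchoredCarrierAt 𝒪 n p 𝔄 𝔖` (PART AA-a):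

* §1 `not_countable_algebraicLocus_of_anchoredCarrierAt_of_hasServedFibre` — on a smooth projective family `f : 𝒳 ⟶ S` of relative
  dimension `n` over a SMOOTH IRREDUCIBLE ONE-DIMENSIONAL base, a fibrewise rational `(p,p)` class `W` with a SERVED FIBRE is algebraic on
  UNCOUNTABLY many fibres: the carrier at the served fibre `s₁` (PART AA-b `exists_lefAtDatum_of_anchoredCarrierAt`: `κ_p = (a·W + Z)|_{s₁}`,
  `κ_q = V_q|_{s₁}`, `Z` fibrewise algebraic) is fed to the door at the model `Iso.refl 𝒳_{s₁}` (Hodge hypothesis: the transport of `V_q|_{s₁}`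
  is `V_q|_t`, of type `(q,q)`), which returns an open set around `s₁` on whose path component `a·W|_t + Z|_t`, hence `W|_t`, is algebraic;
  an open non-empty subset of a smooth curve is uncountable. (The proof of `oneParameterAbelianSchemeVHCUncountable_of_lefAt` per pencil, the
  datum supplied by the anchor instead of by K-SR♭∃; NO abelian, affine, section or regime hypothesis.)
* §2 **`mem_algebraicClasses_of_anchoredCarrierAt_of_hasServedFibre`** — if moreover the total space is quasi-projective and the base
  affine, `W` is algebraic on EVERY fibre: the algebraicity locus is a countable union of Zariski-closed sets (the tree's PROVED
  `charlesSchnell_algebraicityLocus_iUnion_closed_holds`, relative Hilbert schemes) and an uncountable set of points of a curve is thick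
  (`curve_not_subset_iUnion_of_not_countable`, `Theorems.mem_algebraicClasses_of_thickSet`).
* §3 PER VARIETY: `mem_algebraicClasses_of_anchoredCarrierAt_of_servedPencil_through` — a rational `(p,p)` class `w` on ANY fibre `X ≅ 𝒳_s` of
  such a served pencil, with `W|_s ↔ w`, is algebraic; `forall_mem_algebraicClasses_of_anchoredCarrierAt_of_reachable` — the Hodge conjecture
  in codimension `p` for every class REACHABLE from a served anchor (door ∧ anchored carrier ∧ reachability ⟹ algebraic): the
  anchor-generic form of BOTH printed mechanisms on abelian varieties — Markman's (secant anchors `Pic²(C) × Pic²(C)^`, pencils = the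
  Weil locus through them; arXiv:2502.03415 Thm. 1.5.1, PREPRINT) and André's (CM anchors; Publ. IHÉS 83 §6.3) — with the carrier
  statement and the reachability statement as the two explicit hypotheses.
* §4 The road's twisted door at `(6, 3)`: `mem_algebraicClasses_of_twistedPerfectDoorVHC_of_anchoredCarrierAt` (per `C`, route binder
  `TwistedPerfectDoorVHC C AdmTw` by name).
* §5 (appended) The PULL-BACK form of reachability — André's Lemme 6.3.1 output shape: `X` smooth projective, a morphism `g : X ⟶ A₁` to an
  abelian variety `A₁ ≅ 𝒳_s` with `g^*(W|_s) = q·w`, `q ∈ ℚ^×` ⟹ `w` algebraic (`mem_algebraicClasses_of_anchoredCarrierAt_of_servedPencil_pullback`,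
  via the tree's `map_mem_algebraicClasses_of_abelianVariety`).

What is NOT claimed: any anchored carrier statement, any reachability, any door statement, any cell, VHC, `HC_AV`, HC; `HC_CM` nowhere.
References: [cite: BuchweitzFlenner2003, §5 Thm. 5.1] [cite: Bloch1972Semiregularity, Remark (7.5)] [cite: Markman2025SecantWeil, Thm. 1.4.1 and Thm. 1.5.1]
[cite: Andre1996Motifs, §6.3 Lemmes 6.3.1–6.3.3] [cite: CharlesSchnell2014Notes, Prop. 11.3.11 (proof)] [cite: VoisinHodgeII2003, §7.3.2, proof of Thm. 7.19]
[cite: VoisinHodgeI2002, §9.2.1 and Thm. 9.3] [cite: SerreGAGA1956, §2 n°5 Prop. 2 and n°6].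
-/

noncomputable section

open CategoryTheory CategoryTheory.Limits AlgebraicGeometry Topology

namespace Summit.HodgeConjecture.HodgeConjecture.Ring2.SemiregularRepresentatives

-- the cell's namespace repeats the summit name (`Summit.HodgeConjecture.HodgeConjecture…`), as in every `Ring2*` file
set_option linter.dupNamespace false

open Literature.AlgebraicGeometry Literature.AlgebraicGeometry.Motives
open Literature.AlgebraicGeometry.HodgeTheory
open Literature.AlgebraicTopology.SingularHomology
open Literature.Barriers.HodgeConjecture (divisorClassesSpan)
open Summit.HodgeConjecture.HodgeConjecture.Ring2.Binders
open Summit.Ventures.HSemireg (ObjClass LocalVariationalHodgeFor)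

variable {𝒪 : ObjClass} {n p : ℕ}
variable {𝔄 : ∀ X : SchemeOver ℂ, complexBetti X 2 → Prop} {𝔖 : ∀ (X : SchemeOver ℂ), complexBetti X 2 → Set (complexBetti X (2 * p))}
variable {𝒳 S : SchemeOver ℂ} {f : 𝒳 ⟶ S}

/-- Functoriality bookkeeping (`(Iso.refl X).inv^* = id`). [folklore] -/
private theorem map_refl_inv'' (X : SchemeOver ℂ) (k : ℕ) (c : complexBetti X k) :
    complexBetti.map (Iso.refl X).inv k c = c := by
  rw [Iso.refl_inv, complexBetti.map_id]
  rfl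

/-! ## §1 Door ∧ anchored carrier ∧ served fibre ⟹ uncountably many algebraic fibres -/

/-- **DOOR ∧ ANCHORED CARRIER ∧ SERVED FIBRE ⟹ `W` IS ALGEBRAIC ON UNCOUNTABLY MANY FIBRES** (door-, degree-, anchor-generic; fact-free).
`f : 𝒳 ⟶ S` smooth projective of relative dimension `n` over a smooth irreducible one-dimensional base, `W` fibrewise rational of type `(p,p)`
with a served fibre; `𝒪` satisfies its local variational Hodge statement and the anchored carrier statement at `(n, p)`. The carrier at the
served fibre `s₁` is a datum `κ_p = (a·W + Z)|_{s₁}`, `κ_q = V_q|_{s₁}` (PART AA-b); the door at the model `Iso.refl 𝒳_{s₁}` makes the transport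
of `κ_p` — i.e. `a·W|_t + Z|_t` — algebraic on the path component of `s₁` in an open set; `Z|_t` is algebraic, so `W|_t` is, on an
uncountable set. [cite: BuchweitzFlenner2003, §5 Thm. 5.1 (argument shape)] [cite: VoisinHodgeI2002, §9.2.1 and Thm. 9.3]
[cite: Markman2025SecantWeil, Thm. 1.4.1 and Thm. 1.5.1] -/
theorem not_countable_algebraicLocus_of_anchoredCarrierAt_of_hasServedFibre (hT : LocalVariationalHodgeFor 𝒪)
    (hA : AnchoredCarrierAt 𝒪 n p 𝔄 𝔖) (hf : IsSmoothProjectiveFamily f n) (hirr : IrreducibleSpace S.left)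
    (hsm : AlgebraicGeometry.Smooth S.hom) (hdim : topologicalKrullDim S.left = 1) (W : complexBetti 𝒳 (2 * p))
    (hW : ∀ s : ComplexPoints S, IsRationalClass (complexBetti.map (fiberι f s) (2 * p) W) ∧
      IsOfHodgeType n (fiberOver f s) (2 * p) p p (complexBetti.map (fiberι f s) (2 * p) W))
    (hsf : HasServedFibre n p 𝔄 𝔖 f W) :
    ¬ {s : ComplexPoints S | complexBetti.map (fiberι f s) (2 * p) W ∈ algebraicClasses (fiberOver f s) p}.Countable := by
  haveI := hirr
  haveI := hsm
  haveI : LocallyOfFiniteType S.hom := inferInstance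
  haveI : LocallyPathConnectedSpace (ComplexPoints S) := locallyPathConnectedSpace_complexPoints_of_smooth S
  have hU : IsCohomologicallyLocallyTrivialOn f (Set.univ : Set (ComplexPoints S)) :=
    isCohomologicallyLocallyTrivialOn_univ_of_isSmoothProjectiveFamily_of_smooth f hf
  obtain ⟨s₁, I, κ, V, a, Z, hpI, hκ, ha, hZ, hVp, hκV, hVH⟩ := exists_lefAtDatum_of_anchoredCarrierAt hA hf W hW hsf
  let s₁' : (Set.univ : Set (ComplexPoints S)) := ⟨s₁, Set.mem_univ s₁⟩
  have hHodge : ∀ q ∈ I, ∀ (t : (Set.univ : Set (ComplexPoints S))) (γ : Path.Homotopic.Quotient s₁' t),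
      IsOfHodgeType n (fiberOver f t.1) (2 * q) q q
        (transportFun f (2 * q) hU γ (complexBetti.map (Iso.refl (fiberOver f s₁)).inv (2 * q) (κ q))) := by
    intro q hq t γ
    rw [map_refl_inv'', hκV q hq, transportFun_map_fiberι f (2 * q) hU γ (V q)]
    exact hVH q hq t.1
  obtain ⟨W', hWo, hW'₁, hWU, hW'⟩ := hT f n hf hsm hU s₁' (fiberOver f s₁) (Iso.refl _) I κ hκ hHodge
  -- `W` is algebraic on the path component of `s₁` in `W'`
  have halg : ∀ t ∈ pathComponentIn W' s₁,
      complexBetti.map (fiberι f t) (2 * p) W ∈ algebraicClasses (fiberOver f t) p := by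
    intro t ht
    have hj : JoinedIn W' s₁ t := ht
    have hpm : ∀ u, hj.somePath u ∈ W' := hj.somePath_mem
    let γ : Path (⟨s₁, hW'₁⟩ : W') ⟨t, pathComponentIn_subset ht⟩ :=
      { toFun := fun u ↦ ⟨hj.somePath u, hpm u⟩
        continuous_toFun := hj.somePath.continuous.subtype_mk _
        source' := Subtype.ext hj.somePath.source
        target' := Subtype.ext hj.somePath.target }
    have hmem := hW' p hpI ⟨t, pathComponentIn_subset ht⟩ ⟦γ⟧
    have htr : transportFun f (2 * p) (hU.mono hWU hWo) ⟦γ⟧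
        (complexBetti.map (Iso.refl (fiberOver f s₁)).inv (2 * p) (κ p)) =
        a • complexBetti.map (fiberι f t) (2 * p) W + complexBetti.map (fiberι f t) (2 * p) Z := by
      rw [map_refl_inv'', hκV p hpI, transportFun_map_fiberι f (2 * p) (hU.mono hWU hWo) ⟦γ⟧ (V p), hVp,
        map_add, map_smul]
    change transportFun f (2 * p) (hU.mono hWU hWo) ⟦γ⟧
        (complexBetti.map (Iso.refl (fiberOver f s₁)).inv (2 * p) (κ p)) ∈ _ at hmem
    rw [htr] at hmem
    have hWt : complexBetti.map (fiberι f t) (2 * p) W =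
        a⁻¹ • ((a • complexBetti.map (fiberι f t) (2 * p) W + complexBetti.map (fiberι f t) (2 * p) Z) -
          complexBetti.map (fiberι f t) (2 * p) Z) := by
      rw [add_sub_cancel_right, smul_smul, inv_mul_cancel₀ ha, one_smul]
    rw [hWt]
    exact Submodule.smul_mem _ _ (Submodule.sub_mem _ hmem (hZ t).1)
  intro hc
  exact not_countable_of_isOpen_of_curve hdim (hWo.pathComponentIn s₁) ⟨s₁, mem_pathComponentIn_self hW'₁⟩
    (hc.mono fun t ht => halg t ht)

/-! ## §2 … hence algebraic on EVERY fibre (quasi-projective total space, affine base) -/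

/-- **DOOR ∧ ANCHORED CARRIER ∧ SERVED FIBRE ⟹ `W` IS ALGEBRAIC ON EVERY FIBRE** (door-, degree-, anchor-generic; fact-free). In addition to
§1: `𝒳` quasi-projective, `S` affine. The algebraicity locus of `W` is a countable union of Zariski-closed subsets (the tree's proved
`charlesSchnell_algebraicityLocus_iUnion_closed_holds`) containing uncountably many points of the curve, hence all of it. This is the
mechanism of Markman's Thm. 1.5.1 (algebraicity on the whole Weil locus through a secant anchor) and of André's §6.3 (through a CM
anchor), with the anchor, the served classes and the door as parameters. [cite: CharlesSchnell2014Notes, Prop. 11.3.11 (proof)]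
[cite: VoisinHodgeII2003, §7.3.2, proof of Thm. 7.19] [cite: Markman2025SecantWeil, Thm. 1.5.1] [cite: Andre1996Motifs, §6.3] -/
theorem mem_algebraicClasses_of_anchoredCarrierAt_of_hasServedFibre (hT : LocalVariationalHodgeFor 𝒪)
    (hA : AnchoredCarrierAt 𝒪 n p 𝔄 𝔖) (hf : IsSmoothProjectiveFamily f n) (h𝒳 : IsQuasiProjectiveOver 𝒳)
    (hirr : IrreducibleSpace S.left) (haff : IsAffine S.left) (hsm : AlgebraicGeometry.Smooth S.hom)
    (hdim : topologicalKrullDim S.left = 1) (W : complexBetti 𝒳 (2 * p))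
    (hW : ∀ s : ComplexPoints S, IsRationalClass (complexBetti.map (fiberι f s) (2 * p) W) ∧
      IsOfHodgeType n (fiberOver f s) (2 * p) p p (complexBetti.map (fiberι f s) (2 * p) W))
    (hsf : HasServedFibre n p 𝔄 𝔖 f W) (s : ComplexPoints S) :
    complexBetti.map (fiberι f s) (2 * p) W ∈ algebraicClasses (fiberOver f s) p := by
  haveI := hirr
  haveI := haff
  haveI := hsm
  haveI : LocallyOfFiniteType S.hom := inferInstance
  exact Theorems.mem_algebraicClasses_of_thickSet charlesSchnell_algebraicityLocus_iUnion_closed_holds f hf h𝒳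
    (IsQuasiProjectiveOver.of_isAffine S) hsm W
    {t : ComplexPoints S | complexBetti.map (fiberι f t) (2 * p) W ∈ algebraicClasses (fiberOver f t) p}
    (curve_not_subset_iUnion_of_not_countable hdim _
      (not_countable_algebraicLocus_of_anchoredCarrierAt_of_hasServedFibre hT hA hf hirr hsm hdim W hW hsf))
    (fun t ht => ht) s

/-! ## §3 Per variety: classes reachable from a served anchor are algebraic -/

/-- **A rational `(p,p)` class on any fibre of a served pencil is algebraic**: `X ≅ 𝒳_s` a fibre of a pencil as in §2, `w` on `X`
corresponding to `W|_s` under the isomorphism. [cite: Markman2025SecantWeil, Thm. 1.5.1] [cite: Andre1996Motifs, §6.3]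
[cite: CharlesSchnell2014Notes, Prop. 11.3.11 (proof)] -/
theorem mem_algebraicClasses_of_anchoredCarrierAt_of_servedPencil_through (hT : LocalVariationalHodgeFor 𝒪)
    (hA : AnchoredCarrierAt 𝒪 n p 𝔄 𝔖) (hf : IsSmoothProjectiveFamily f n) (h𝒳 : IsQuasiProjectiveOver 𝒳)
    (hirr : IrreducibleSpace S.left) (haff : IsAffine S.left) (hsm : AlgebraicGeometry.Smooth S.hom)
    (hdim : topologicalKrullDim S.left = 1) (W : complexBetti 𝒳 (2 * p))
    (hW : ∀ s : ComplexPoints S, IsRationalClass (complexBetti.map (fiberι f s) (2 * p) W) ∧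
      IsOfHodgeType n (fiberOver f s) (2 * p) p p (complexBetti.map (fiberι f s) (2 * p) W))
    (hsf : HasServedFibre n p 𝔄 𝔖 f W) {X : SchemeOver ℂ} {s : ComplexPoints S} (e : X ≅ fiberOver f s)
    (w : complexBetti X (2 * p)) (hw : complexBetti.map e.inv (2 * p) w = complexBetti.map (fiberι f s) (2 * p) W) :
    w ∈ algebraicClasses X p := by
  have h := mem_algebraicClasses_of_anchoredCarrierAt_of_hasServedFibre hT hA hf h𝒳 hirr haff hsm hdim W hW hsf s
  rw [← hw, ← Iso.symm_hom] at h
  exact (mem_algebraicClasses_map_iff_of_iso e.symm).1 h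

/-- **THE HODGE CONJECTURE IN CODIMENSION `p` FOR EVERY CLASS REACHABLE FROM A SERVED ANCHOR** (door ∧ anchored carrier ∧ reachability
⟹ algebraic; anchor-generic, fact-free). `Reachable X w` is spelled out: a smooth projective family of relative dimension `n` with
quasi-projective total space over a smooth irreducible affine curve, a fibre `≅ X`, a global class `W` fibrewise rational `(p,p)`
restricting to (the transport of) `w`, and a served fibre. Both printed mechanisms on abelian varieties are instances: Markman (secant
anchors, the Weil locus) and André (CM anchors). [cite: Markman2025SecantWeil, Thm. 1.4.1 and Thm. 1.5.1]
[cite: Andre1996Motifs, §6.3 Lemmes 6.3.1–6.3.3] [cite: BuchweitzFlenner2003, §5 Thm. 5.1] -/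
theorem forall_mem_algebraicClasses_of_anchoredCarrierAt_of_reachable (hT : LocalVariationalHodgeFor 𝒪)
    (hA : AnchoredCarrierAt 𝒪 n p 𝔄 𝔖) (𝒱 : SchemeOver ℂ → Prop)
    (hreach : ∀ X : SchemeOver ℂ, 𝒱 X → ∀ w : complexBetti X (2 * p), IsRationalClass w → IsOfHodgeType n X (2 * p) p p w →
      ∃ (𝒳 S : SchemeOver ℂ) (f : 𝒳 ⟶ S) (s : ComplexPoints S) (e : X ≅ fiberOver f s) (W : complexBetti 𝒳 (2 * p)),
        IsSmoothProjectiveFamily f n ∧ IsQuasiProjectiveOver 𝒳 ∧ IrreducibleSpace S.left ∧ IsAffine S.left ∧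
        AlgebraicGeometry.Smooth S.hom ∧ topologicalKrullDim S.left = 1 ∧
        (∀ t : ComplexPoints S, IsRationalClass (complexBetti.map (fiberι f t) (2 * p) W) ∧
          IsOfHodgeType n (fiberOver f t) (2 * p) p p (complexBetti.map (fiberι f t) (2 * p) W)) ∧
        complexBetti.map e.inv (2 * p) w = complexBetti.map (fiberι f s) (2 * p) W ∧
        HasServedFibre n p 𝔄 𝔖 f W) :
    ∀ X : SchemeOver ℂ, 𝒱 X → ∀ w : complexBetti X (2 * p), IsRationalClass w → IsOfHodgeType n X (2 * p) p p w →
      w ∈ algebraicClasses X p := by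
  intro X hX w hwQ hwH
  obtain ⟨𝒳, S, f, s, e, W, hf, h𝒳, hirr, haff, hsm, hdim, hW, hw, hsf⟩ := hreach X hX w hwQ hwH
  exact mem_algebraicClasses_of_anchoredCarrierAt_of_servedPencil_through hT hA hf h𝒳 hirr haff hsm hdim W hW hsf e w hw

/-! ## §4 The road's twisted door at `(6, 3)` -/

/-- **For the road's twisted door, per Chern character theory `C`**: the route binder `TwistedPerfectDoorVHC C AdmTw` (IS
`LocalVariationalHodgeFor (twistedReflexiveClass C AdmTw)`, `Iff.rfl`) and an anchored carrier statement at `(6, 3)` make every fibrewise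
rational `(3,3)` class on every sixfold pencil (smooth projective, quasi-projective total space, smooth irreducible affine curve base)
THROUGH A SERVED ANCHOR algebraic on every fibre — the kernel form of «secant sheaves at the anchor ⟹ algebraicity on the whole Weil
locus through it», with the anchor data as parameters. [cite: Markman2025SecantWeil, Thm. 1.4.1 and Thm. 1.5.1]
[cite: Pridham2024Semiregularity, Cor. 2.25 and Rem. 2.27] [cite: BuchweitzFlenner2003, §5 Thm. 5.1] -/
theorem mem_algebraicClasses_of_twistedPerfectDoorVHC_of_anchoredCarrierAt {C : ChernCharacterBetti} {Adm : PerfectAdmissibility}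
    (hT : TwistedPerfectDoorVHC C Adm) {m q : ℕ}
    {𝔖' : ∀ (X : SchemeOver ℂ), complexBetti X 2 → Set (complexBetti X (2 * q))}
    (hA : AnchoredCarrierAt (twistedReflexiveClass C Adm) m q 𝔄 𝔖') (hf : IsSmoothProjectiveFamily f m)
    (h𝒳 : IsQuasiProjectiveOver 𝒳) (hirr : IrreducibleSpace S.left) (haff : IsAffine S.left) (hsm : AlgebraicGeometry.Smooth S.hom)
    (hdim : topologicalKrullDim S.left = 1) (W : complexBetti 𝒳 (2 * q))
    (hW : ∀ s : ComplexPoints S, IsRationalClass (complexBetti.map (fiberι f s) (2 * q) W) ∧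
      IsOfHodgeType m (fiberOver f s) (2 * q) q q (complexBetti.map (fiberι f s) (2 * q) W))
    (hsf : HasServedFibre m q 𝔄 𝔖' f W) (s : ComplexPoints S) :
    complexBetti.map (fiberι f s) (2 * q) W ∈ algebraicClasses (fiberOver f s) q :=
  mem_algebraicClasses_of_anchoredCarrierAt_of_hasServedFibre
    ((twistedPerfectDoorVHC_iff_localVariationalHodgeFor C Adm).1 hT) hA hf h𝒳 hirr haff hsm hdim W hW hsf s

/-! ## §5 The pull-back form of reachability (André's Lemme 6.3.1 output shape; appended) -/

/-- **Classes PULLED BACK from a fibre of a served pencil are algebraic** (anchor-generic, fact-free): `X` smooth projective of dimension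
`n'`, `A₁` an abelian variety with `e₁ : A₁.X ≅ 𝒳_s` a fibre of a served pencil as in §2, `g : X ⟶ A₁.X` any morphism, and
`g^*(e₁^*(W|_s)) = q·w` with `q ∈ ℚ`, `q ≠ 0` ⟹ `w ∈ Nᵖ H^{2p}(X)` (pull-back to an abelian variety preserves algebraic classes — the
tree's `map_mem_algebraicClasses_of_abelianVariety`, Kleiman transversality by translates). This is the OUTPUT SHAPE of André's
Lemme 6.3.1 (the tree's `andre1996_cmAnchoredPencil`: a pencil of relative dimension `2·dim A` through `q·c` via a morphism to a fibre),
so CM-anchored reachability is an instance up to the base (André's pencils are compact: restrict to an affine chart containing both the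
anchor fibre and `s`). [cite: Andre1996Motifs, §6.3 Lemme 6.3.1] [cite: Fulton1998, §19.2 Cor. 19.2 (b) and Appendix B.9.2 (a)]
[cite: Markman2025SecantWeil, Thm. 1.5.1] -/
theorem mem_algebraicClasses_of_anchoredCarrierAt_of_servedPencil_pullback (hT : LocalVariationalHodgeFor 𝒪)
    (hA : AnchoredCarrierAt 𝒪 n p 𝔄 𝔖) (hf : IsSmoothProjectiveFamily f n) (h𝒳 : IsQuasiProjectiveOver 𝒳)
    (hirr : IrreducibleSpace S.left) (haff : IsAffine S.left) (hsm : AlgebraicGeometry.Smooth S.hom)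
    (hdim : topologicalKrullDim S.left = 1) (W : complexBetti 𝒳 (2 * p))
    (hW : ∀ s : ComplexPoints S, IsRationalClass (complexBetti.map (fiberι f s) (2 * p) W) ∧
      IsOfHodgeType n (fiberOver f s) (2 * p) p p (complexBetti.map (fiberι f s) (2 * p) W))
    (hsf : HasServedFibre n p 𝔄 𝔖 f W) {s : ComplexPoints S} (A₁ : AbelianVariety ℂ) (e₁ : A₁.X ≅ fiberOver f s)
    {n' : ℕ} {X : SchemeOver ℂ} (hX : IsSmoothProjective n' X) (g : X ⟶ A₁.X) (w : complexBetti X (2 * p)) (q : ℚ) (hq : q ≠ 0)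
    (hgw : complexBetti.map g (2 * p) (complexBetti.map e₁.hom (2 * p) (complexBetti.map (fiberι f s) (2 * p) W)) = (q : ℂ) • w) :
    w ∈ algebraicClasses X p := by
  have h₁ := mem_algebraicClasses_of_anchoredCarrierAt_of_hasServedFibre hT hA hf h𝒳 hirr haff hsm hdim W hW hsf s
  have h₂ : complexBetti.map e₁.hom (2 * p) (complexBetti.map (fiberι f s) (2 * p) W) ∈ algebraicClasses A₁.X p :=
    (mem_algebraicClasses_map_iff_of_iso e₁).2 h₁
  have h₃ : ((q : ℂ)) • w ∈ algebraicClasses X p := by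
    rw [← hgw]
    exact map_mem_algebraicClasses_of_abelianVariety hX A₁ g h₂
  exact (Submodule.smul_mem_iff _ (Rat.cast_ne_zero.2 hq)).1 h₃


end Summit.HodgeConjecture.HodgeConjecture.Ring2.SemiregularRepresentatives

end
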